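import Summits.ValiantsHypothesis.ValiantsHypothesis.Theorems.FeketeSOSFeketeSOSHardPaleyRIPIntervalExp
import Mathlib.RingTheory.RootsOfUnity.Complex
import Mathlib.Data.ZMod.Basic

/-!
# Route FeketeSOS — crux `FeketeSOSHard` (stmt-ValiantsHypothesis-3996), line `paley-rip` v3,
# `stub_tameOperator` piece (B), Fourier form: `μ_H(g) ≤ (‖ĝ‖₁/N)·(⌊log₂ k⌋ + 5/2)` on an interval block

The census (`Cruxes/FeketeSOSHard/Lines/paley-rip-stub3-census.md` §6 (B)) phrases the consequence of the "R_k lemma"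
as `μ_H(g) ≲ (‖ĝ‖₁/N) · polylog k` for a pattern `g` on `H + H`, `H = [0,k)`, `ĝ` its length-`N` DFT: narrow-band
blocks (few large Fourier coefficients) are cheap.  `…PaleyRIPIntervalExp.lean` proved it for explicit
superpositions of exponentials; this file supplies the discrete Fourier inversion that turns ANY pattern of
degree `< N = 2k − 1` into such a superposition, and states the bound verbatim:

* `rootOfUnity_char_sum` — orthogonality `Σ_{j<N} ζ^{j(m + (N−1)n)} = N·𝟙[m = n]` (`m, n < N`, via `ZMod N`);
* `dft_inversion` — `P = Σ_{j<N} (P(ζ^j)/N) Σ_{n<N} (ζ^{−j})^n X^n` for `deg P < N` (`ζ^{−j}` written `ζ^{j(N−1)}`);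
* `pattern_fourier_rep` (any primitive `ζ`) / `pattern_fourier_rep_exp` (`ζ = e^{2πi/N}`): for `S ⊇ (d+H) ∪ (d'+H)`
  the pattern `X^{d+d'} P` has weighted squares supported in `S` of mass
  `≤ (Σ_{j<N} |P(ζ^j)| / N) · (Nat.log 2 k + 5/2)`;
* `norm_eval_le_sum_norm_coeff` — sanity: the bound never exceeds `‖P‖_{ℓ¹}(Nat.log 2 k + 5/2)`.

Honest framing (rung currency): Theorems-side helper `--supports` stmt-3996; nothing closes; `stub_tameOperator`
(r ≥ 2), `stub_paleyFlatRIP` and the crux stay OPEN; `VP ≠ VNP` is untouched.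
-/

set_option linter.dupNamespace false

namespace Summit.ValiantsHypothesis.ValiantsHypothesis.Theorems.FeketeSOSHardPaleyRIP

open Polynomial Finset
open scoped BigOperators

noncomputable section

/-! ## Discrete Fourier inversion for polynomials of degree `< N` -/

/-- Orthogonality of characters: for a primitive `N`-th root `ζ` and `m, n < N`,
`Σ_{j<N} (ζ^{m + (N−1) n})^j = N·𝟙[m = n]`. [folklore] -/
theorem rootOfUnity_char_sum (N : ℕ) (hN : 0 < N) (ζ : ℂ) (hζ : IsPrimitiveRoot ζ N) (m n : ℕ)
    (hm : m < N) (hn : n < N) :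
    (∑ j ∈ range N, (ζ ^ (m + (N - 1) * n)) ^ j) = if m = n then (N : ℂ) else 0 := by
  have hNz : NeZero N := ⟨hN.ne'⟩
  -- `N ∣ m + (N−1) n ↔ m = n`
  have hdvd : N ∣ m + (N - 1) * n ↔ m = n := by
    rw [← ZMod.natCast_eq_zero_iff]
    have hcast : ((m + (N - 1) * n : ℕ) : ZMod N) = (m : ZMod N) - (n : ZMod N) := by
      have h1 : ((N - 1 : ℕ) : ZMod N) = -1 := by
        rw [Nat.cast_sub (by omega), Nat.cast_one, ZMod.natCast_self, zero_sub]
      push_cast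
      rw [h1]
      ring
    rw [hcast, sub_eq_zero, ZMod.natCast_eq_natCast_iff', Nat.mod_eq_of_lt hm, Nat.mod_eq_of_lt hn]
  by_cases hmn : m = n
  · rw [if_pos hmn]
    have h1 : ζ ^ (m + (N - 1) * n) = 1 := (hζ.pow_eq_one_iff_dvd _).2 (hdvd.2 hmn)
    rw [h1]
    simp
  · rw [if_neg hmn]
    have h1 : ζ ^ (m + (N - 1) * n) ≠ 1 := fun h => hmn (hdvd.1 ((hζ.pow_eq_one_iff_dvd _).1 h))
    rw [geom_sum_eq h1, ← pow_mul, mul_comm, pow_mul, hζ.pow_eq_one, one_pow, sub_self, zero_div]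

/-- Coefficients of an exponential pattern: `[X^n] Σ_{m<N} u^m X^m = 𝟙[n < N] u^n`. [folklore] -/
theorem coeff_expPattern (N : ℕ) (u : ℂ) (n : ℕ) :
    (∑ m ∈ range N, C (u ^ m) * (X : ℂ[X]) ^ m).coeff n = if n < N then u ^ n else 0 := by
  rw [finsetSum_coeff]
  simp only [coeff_C_mul_X_pow]
  rw [Finset.sum_ite_eq (range N) n]
  simp only [mem_range]

/-- **Discrete Fourier inversion.**  If `deg P < N` and `ζ` is a primitive `N`-th root of unity then
`P = Σ_{j<N} (P(ζ^j)/N) · Σ_{n<N} (ζ^{j(N−1)})^n X^n` — `P` is a superposition of the `N` exponential patterns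
with coefficients its values on the `N`-th roots of unity (`ζ^{j(N−1)} = ζ^{−j}`). [folklore] -/
theorem dft_inversion (N : ℕ) (hN : 0 < N) (ζ : ℂ) (hζ : IsPrimitiveRoot ζ N) (P : ℂ[X])
    (hP : P.natDegree < N) :
    P = ∑ j ∈ range N, C (P.eval (ζ ^ j) / N) *
      ∑ n ∈ range N, C ((ζ ^ (j * (N - 1))) ^ n) * (X : ℂ[X]) ^ n := by
  have hNc : (N : ℂ) ≠ 0 := Nat.cast_ne_zero.2 hN.ne'
  ext n
  rw [finsetSum_coeff]
  simp only [coeff_C_mul, coeff_expPattern]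
  by_cases hn : n < N
  · simp only [if_pos hn]
    -- expand `P(ζ^j)` and swap the sums
    have hev : ∀ j, P.eval (ζ ^ j) = ∑ m ∈ range N, P.coeff m * (ζ ^ j) ^ m :=
      fun j => eval_eq_sum_range' hP _
    simp_rw [hev, Finset.sum_div, Finset.sum_mul]
    rw [Finset.sum_comm]
    have hinner : ∀ m ∈ range N,
        (∑ j ∈ range N, P.coeff m * (ζ ^ j) ^ m / N * (ζ ^ (j * (N - 1))) ^ n) =
          P.coeff m / N * ∑ j ∈ range N, (ζ ^ (m + (N - 1) * n)) ^ j := by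
      intro m _
      rw [Finset.mul_sum]
      refine Finset.sum_congr rfl fun j _ => ?_
      rw [← pow_mul, ← pow_mul, ← pow_mul]
      ring
    rw [Finset.sum_congr rfl hinner,
      Finset.sum_congr rfl fun m hm => by rw [rootOfUnity_char_sum N hN ζ hζ m n (mem_range.1 hm) hn],
      Finset.sum_eq_single n]
    · rw [if_pos rfl]; field_simp
    · intro m _ hmn; rw [if_neg hmn, mul_zero]
    · intro h; exact absurd (mem_range.2 hn) h
  · simp only [if_neg hn, mul_zero, Finset.sum_const_zero]
    exact coeff_eq_zero_of_natDegree_lt (by omega)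

/-! ## Any pattern on an interval sum-block: mass `≤ (ℓ¹ of its DFT / N) · (⌊log₂ k⌋ + 5/2)` -/

/-- **Census piece (B), second half, verbatim: `μ_H(g) ≤ (‖ĝ‖₁/N)·(⌊log₂ k⌋ + 5/2)`.**  Let `k ≥ 1`,
`N = 2k − 1`, `ζ` a primitive `N`-th root of unity, `P` a pattern of degree `< N` (i.e. on `H + H`,
`H = [0,k)`), shifts `d, d'` and `S ⊇ (d + H) ∪ (d' + H)`.  Then `X^{d+d'} P` is `Σ_j c_j w_j²` with
`supp w_j ⊆ S` and mass `≤ (Σ_{j<N} |P(ζ^j)| / N) · (Nat.log 2 k + 5/2)` — DFT inversion plus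
`exp_block_superposition_rep`. [folklore] -/
theorem pattern_fourier_rep (k : ℕ) (hk : 1 ≤ k) (ζ : ℂ) (hζ : IsPrimitiveRoot ζ (2 * k - 1)) (P : ℂ[X])
    (hP : P.natDegree < 2 * k - 1) (d d' : ℕ) (S : Finset ℕ)
    (hd : ∀ i, i < k → d + i ∈ S) (hd' : ∀ i, i < k → d' + i ∈ S) :
    ∃ (s : ℕ) (c : Fin s → ℂ) (w : Fin s → ℂ[X]), (∀ j, (w j).support ⊆ S) ∧
      (∑ j, C (c j) * w j ^ 2) = X ^ (d + d') * P ∧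
      (∑ j, sqMass (c j) (w j)) ≤
        (∑ j ∈ range (2 * k - 1), ‖P.eval (ζ ^ j)‖ / ((2 * k - 1 : ℕ) : ℝ)) * ((Nat.log 2 k : ℝ) + 5 / 2) := by
  have hN : 0 < 2 * k - 1 := by omega
  have hζ1 : ‖ζ‖ = 1 := hζ.norm'_eq_one hN.ne'
  have hu : ∀ j ∈ range (2 * k - 1), ‖ζ ^ (j * (2 * k - 1 - 1))‖ = 1 := fun j _ => by
    rw [norm_pow, hζ1, one_pow]
  have h := exp_block_superposition_rep (range (2 * k - 1)) (fun j => P.eval (ζ ^ j) / (2 * k - 1 : ℕ))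
    (fun j => ζ ^ (j * (2 * k - 1 - 1))) hu k hk d d' S hd hd'
  refine rep_congr ?_ (le_of_eq ?_) h
  · conv_rhs => rw [dft_inversion (2 * k - 1) hN ζ hζ P hP]
    rw [Finset.mul_sum]
    exact Finset.sum_congr rfl fun j _ => by ring
  · congr 1
    refine Finset.sum_congr rfl fun j _ => ?_
    rw [norm_div, Complex.norm_natCast]

/-- The same with the standard root `ζ = exp(2πi/(2k−1))` (Mathlib `Complex.isPrimitiveRoot_exp`). [folklore] -/
theorem pattern_fourier_rep_exp (k : ℕ) (hk : 1 ≤ k) (P : ℂ[X]) (hP : P.natDegree < 2 * k - 1) (d d' : ℕ)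
    (S : Finset ℕ) (hd : ∀ i, i < k → d + i ∈ S) (hd' : ∀ i, i < k → d' + i ∈ S) :
    ∃ (s : ℕ) (c : Fin s → ℂ) (w : Fin s → ℂ[X]), (∀ j, (w j).support ⊆ S) ∧
      (∑ j, C (c j) * w j ^ 2) = X ^ (d + d') * P ∧
      (∑ j, sqMass (c j) (w j)) ≤
        (∑ j ∈ range (2 * k - 1),
            ‖P.eval (Complex.exp (2 * Real.pi * Complex.I / ((2 * k - 1 : ℕ) : ℂ)) ^ j)‖ /
              ((2 * k - 1 : ℕ) : ℝ)) * ((Nat.log 2 k : ℝ) + 5 / 2) :=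
  pattern_fourier_rep k hk _ (Complex.isPrimitiveRoot_exp (2 * k - 1) (by omega)) P hP d d' S hd hd'

/-- **Trivial-character bound as a sanity check**: `|P(ζ^j)| ≤ Σ_n |P_n|`, so the Fourier bound is never worse
than `‖P‖_{ℓ¹} (Nat.log 2 k + 5/2)` (vs. the `ℓ¹`-spreading certificate `‖P‖_{ℓ¹}` of the census, P2); its point
is patterns whose DFT is sparse (narrow-band blocks), where `Σ_j |P(ζ^j)|/N ≪ ‖P‖_{ℓ¹}`. [folklore] -/
theorem norm_eval_le_sum_norm_coeff (P : ℂ[X]) (N : ℕ) (hP : P.natDegree < N) (u : ℂ) (hu : ‖u‖ = 1) :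
    ‖P.eval u‖ ≤ ∑ n ∈ range N, ‖P.coeff n‖ := by
  rw [eval_eq_sum_range' hP]
  refine (norm_sum_le _ _).trans (Finset.sum_le_sum fun n _ => ?_)
  rw [norm_mul, norm_pow, hu, one_pow, mul_one]

/-! ## Parseval at roots of unity and the `ℓ²` form: `μ ≤ ‖P‖₂ · (⌊log₂ k⌋ + 5/2)` (appended) -/

/-- For a unimodular complex number, `conj u = u⁻¹`. [folklore] -/
theorem conj_eq_inv_of_norm_eq_one (u : ℂ) (hu : ‖u‖ = 1) : (starRingEnd ℂ) u = u⁻¹ := by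
  rw [Complex.inv_def, Complex.normSq_eq_norm_sq, hu]
  simp

/-- **Parseval at the `N`-th roots of unity**: for `deg P < N` and `ζ` a primitive `N`-th root,
`Σ_{j<N} |P(ζ^j)|² = N · Σ_{n<N} |P_n|²`. [folklore] -/
theorem parseval_rootsOfUnity (N : ℕ) (hN : 0 < N) (ζ : ℂ) (hζ : IsPrimitiveRoot ζ N) (P : ℂ[X])
    (hP : P.natDegree < N) :
    (∑ j ∈ range N, ‖P.eval (ζ ^ j)‖ ^ 2) = N * ∑ n ∈ range N, ‖P.coeff n‖ ^ 2 := by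
  have hζ1 : ‖ζ‖ = 1 := hζ.norm'_eq_one hN.ne'
  -- `conj ζ = ζ^{N−1}`
  have hconj : (starRingEnd ℂ) ζ = ζ ^ (N - 1) := by
    rw [conj_eq_inv_of_norm_eq_one ζ hζ1]
    have h : ζ ^ (N - 1) * ζ = 1 := by
      rw [← pow_succ, Nat.sub_add_cancel hN, hζ.pow_eq_one]
    have hζ0 : ζ ≠ 0 := fun h0 => by rw [h0, norm_zero] at hζ1; exact zero_ne_one hζ1
    exact (eq_inv_of_mul_eq_one_left h).symm
  -- work in `ℂ`
  have key : ∀ j : ℕ, ((‖P.eval (ζ ^ j)‖ : ℂ)) ^ 2 =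
      ∑ m ∈ range N, ∑ n ∈ range N, P.coeff m * (starRingEnd ℂ) (P.coeff n) * (ζ ^ (m + (N - 1) * n)) ^ j := by
    intro j
    rw [← Complex.mul_conj', eval_eq_sum_range' hP, map_sum, Finset.sum_mul_sum]
    refine Finset.sum_congr rfl fun m _ => Finset.sum_congr rfl fun n _ => ?_
    rw [map_mul, map_pow, map_pow, hconj, ← pow_mul, ← pow_mul, ← pow_mul, ← pow_mul]
    ring
  have hsum : ((∑ j ∈ range N, ‖P.eval (ζ ^ j)‖ ^ 2 : ℝ) : ℂ) =
      ((N * ∑ n ∈ range N, ‖P.coeff n‖ ^ 2 : ℝ) : ℂ) := by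
    push_cast
    rw [Finset.sum_congr rfl fun j _ => key j, Finset.sum_comm]
    rw [Finset.sum_congr rfl fun m _ => Finset.sum_comm, Finset.mul_sum]
    refine Finset.sum_congr rfl fun m hm => ?_
    rw [Finset.sum_congr rfl fun n hn => by
      rw [← Finset.mul_sum, rootOfUnity_char_sum N hN ζ hζ m n (mem_range.1 hm) (mem_range.1 hn)],
      Finset.sum_eq_single m]
    · rw [if_pos rfl, Complex.mul_conj']
      ring
    · intro n _ hnm
      rw [if_neg (Ne.symm hnm), mul_zero]
    · intro h
      exact absurd hm h
  exact_mod_cast hsum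

/-- Cauchy–Schwarz consequence: `Σ_{j<N} |P(ζ^j)| / N ≤ ‖P‖₂ = (Σ_{n<N} |P_n|²)^{1/2}`. [folklore] -/
theorem sum_norm_eval_div_le_l2 (N : ℕ) (hN : 0 < N) (ζ : ℂ) (hζ : IsPrimitiveRoot ζ N) (P : ℂ[X])
    (hP : P.natDegree < N) :
    (∑ j ∈ range N, ‖P.eval (ζ ^ j)‖ / (N : ℝ)) ≤ Real.sqrt (∑ n ∈ range N, ‖P.coeff n‖ ^ 2) := by
  have hNr : (0 : ℝ) < N := by exact_mod_cast hN
  rw [← Finset.sum_div, div_le_iff₀ hNr]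
  have hcs := Finset.sum_mul_sq_le_sq_mul_sq (range N) (fun j => ‖P.eval (ζ ^ j)‖) (fun _ => (1 : ℝ))
  simp only [mul_one, one_pow, Finset.sum_const, Finset.card_range, nsmul_eq_mul, mul_one] at hcs
  rw [parseval_rootsOfUnity N hN ζ hζ P hP] at hcs
  -- `(Σ |P(ζ^j)|)² ≤ N² ‖P‖₂²`
  have h0 : 0 ≤ ∑ j ∈ range N, ‖P.eval (ζ ^ j)‖ := Finset.sum_nonneg fun _ _ => norm_nonneg _
  have h1 : 0 ≤ Real.sqrt (∑ n ∈ range N, ‖P.coeff n‖ ^ 2) * N := by positivity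
  have h2 : (Real.sqrt (∑ n ∈ range N, ‖P.coeff n‖ ^ 2) * N) ^ 2 = N * (N * ∑ n ∈ range N, ‖P.coeff n‖ ^ 2) := by
    rw [mul_pow, Real.sq_sqrt (Finset.sum_nonneg fun _ _ => sq_nonneg _)]
    ring
  nlinarith [h2, hcs, h0, h1, sq_nonneg (∑ j ∈ range N, ‖P.eval (ζ ^ j)‖ - Real.sqrt (∑ n ∈ range N, ‖P.coeff n‖ ^ 2) * N)]

/-- **`ℓ²` form of piece (B): every pattern on an interval sum-block costs at most its `ℓ²` norm times
`⌊log₂ k⌋ + 5/2`.**  For `k ≥ 1`, `deg P < 2k − 1`, shifts `d, d'` and `S ⊇ (d + [0,k)) ∪ (d' + [0,k))`: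
`X^{d+d'} P = Σ_j c_j w_j²` with `supp w_j ⊆ S` and `Σ_j |c_j|‖w_j‖₂² ≤ ‖P‖₂ · (Nat.log 2 k + 5/2)` — no rank
enters (on an interval the census's `√r·‖R_k‖_{S₁}·‖y‖₂` of §9 improves to `‖y‖₂(⌊log₂k⌋ + 5/2)`).
[folklore] -/
theorem pattern_l2_rep (k : ℕ) (hk : 1 ≤ k) (P : ℂ[X]) (hP : P.natDegree < 2 * k - 1) (d d' : ℕ)
    (S : Finset ℕ) (hd : ∀ i, i < k → d + i ∈ S) (hd' : ∀ i, i < k → d' + i ∈ S) :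
    ∃ (s : ℕ) (c : Fin s → ℂ) (w : Fin s → ℂ[X]), (∀ j, (w j).support ⊆ S) ∧
      (∑ j, C (c j) * w j ^ 2) = X ^ (d + d') * P ∧
      (∑ j, sqMass (c j) (w j)) ≤
        Real.sqrt (∑ n ∈ range (2 * k - 1), ‖P.coeff n‖ ^ 2) * ((Nat.log 2 k : ℝ) + 5 / 2) := by
  have hN : 0 < 2 * k - 1 := by omega
  have hζ := Complex.isPrimitiveRoot_exp (2 * k - 1) hN.ne'
  refine rep_congr rfl ?_ (pattern_fourier_rep k hk _ hζ P hP d d' S hd hd')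
  exact mul_le_mul_of_nonneg_right (sum_norm_eval_div_le_l2 _ hN _ hζ P hP) (by positivity)

end

end Summit.ValiantsHypothesis.ValiantsHypothesis.Theorems.FeketeSOSHardPaleyRIP
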